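import Summits.CriticalPhenomena.PercolationContinuityZ3.Theorems.SahiAEOpenBandRegularity

/-!
# Open bands in every dimension: the corrected density and its local charts

Support file of the Sahi cell (`prim-sahi`, typer seat, generation 25; `--supports stmt-CriticalPhenomena-4575`).
Small definitions (`corrDensity`, `endpts`), theorems otherwise; no named facts, no sorries.

Fifth file of the structure theorem for densities with zeros in every dimension.  For an open band `U ⊆ ℝ^ι`, a
measurable `φ` supermodular on almost every pair of `U`, and a dense generic family `c` (`BandFamily`), the
**corrected density** is

  `corrDensity U φ c = 𝟙_U · exp(φ − lineSum U φ c)`,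

an a.e.-MTP₂ density on `ℝ^ι` (`ae_mtp2_corrDensity`: the separable correction is modular).  Its lower-corner
envelope will be the version (`SahiAEOpenBandVersion.lean`); here we describe it locally from the lower-left:

* `ae_corrDensity_chart` — above a family point `c_m`, on the points `x > c_m` with `[c_m, x]` inside a rational box
  carrying a patch function, `corrDensity = F_m · exp(Σᵢ (φ(c_m; i := xᵢ) − lineValue i xᵢ) − (|ι| − 1) φ(c_m))`
  almost everywhere, `F_m` the (everywhere monotone, finite, positive) envelope of the orthant density of the patched
  function (`boxVersion_ae_eq` of generation 24 and locality);
* `exists_coordChart` — at every point `p` of the arm box of `c_m` and in every direction `i`: an index `κ` selected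
  at all heights just below `pᵢ`, a family line `c_l` above both `c_m` and `c_κ`, and a rational window around `pᵢ`
  over which the three lines run in `U` (valid one-dimensional charts for the line gaps `φ(c_l;·) − φ(c_m;·)` and
  `φ(c_l;·) − φ(c_κ;·)`, whose difference is `φ(c_m;·) − φ(c_κ;·)`);
* `endpts` — the countable set of end-heights of the robust height sets, off which the left-selected index is also
  the index selected at the height itself (`gIdx_eq_of_not_mem_endpts`).

No sorries, no new axioms.
-/

noncomputable section

namespace Summit.CriticalPhenomena.PercolationContinuityZ3.Theorems.SahiAEFourFunctions

open MeasureTheory Set Filter Topology Function Metric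
open scoped ENNReal NNReal

variable {ι : Type*} [Fintype ι] [DecidableEq ι]

/-! ### The corrected density -/

/-- **The corrected density** `𝟙_U · exp(φ − lineSum)`. [this work] -/
def corrDensity (U : Set (ι → ℝ)) (φ : (ι → ℝ) → ℝ) (c : ℕ → ι → ℝ) : (ι → ℝ) → ℝ≥0∞ :=
  U.indicator fun x => ENNReal.ofReal (Real.exp (φ x - lineSum U φ c x))

/-- The corrected density on `U`. [folklore] -/
theorem corrDensity_of_mem {U : Set (ι → ℝ)} {φ : (ι → ℝ) → ℝ} {c : ℕ → ι → ℝ} {x : ι → ℝ} (hx : x ∈ U) :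
    corrDensity U φ c x = ENNReal.ofReal (Real.exp (φ x - lineSum U φ c x)) := by
  simp only [corrDensity, Set.indicator_of_mem hx]

/-- The corrected density off `U`. [folklore] -/
theorem corrDensity_of_not_mem {U : Set (ι → ℝ)} {φ : (ι → ℝ) → ℝ} {c : ℕ → ι → ℝ} {x : ι → ℝ} (hx : x ∉ U) :
    corrDensity U φ c x = 0 := by
  simp only [corrDensity, Set.indicator_of_notMem hx]

/-- The corrected density is finite. [folklore] -/
theorem corrDensity_ne_top (U : Set (ι → ℝ)) (φ : (ι → ℝ) → ℝ) (c : ℕ → ι → ℝ) (x : ι → ℝ) :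
    corrDensity U φ c x ≠ ∞ := by
  by_cases hx : x ∈ U
  · rw [corrDensity_of_mem hx]; exact ENNReal.ofReal_ne_top
  · rw [corrDensity_of_not_mem hx]; exact ENNReal.zero_ne_top

/-- The corrected density is measurable. [folklore] -/
theorem measurable_corrDensity {U : Set (ι → ℝ)} (hUo : IsOpen U) {φ : (ι → ℝ) → ℝ} (hφ : Measurable φ)
    (c : ℕ → ι → ℝ) : Measurable (corrDensity U φ c) :=
  (ENNReal.measurable_ofReal.comp (Real.measurable_exp.comp (hφ.sub (measurable_lineSum hUo hφ c)))).indicator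
    hUo.measurableSet

/-- **The corrected density is MTP₂ on almost every pair of `ℝ^ι`** (the correction is modular, `U` is a
sublattice, and the density vanishes off `U`). [this work] -/
theorem ae_mtp2_corrDensity {U : Set (ι → ℝ)} (hU : IsOpenBand U) {φ : (ι → ℝ) → ℝ}
    (hsmU : ∀ᵐ q ∂(volume : Measure (ι → ℝ)).prod volume,
      q.1 ∈ U → q.2 ∈ U → φ q.1 + φ q.2 ≤ φ (q.1 ⊓ q.2) + φ (q.1 ⊔ q.2)) (c : ℕ → ι → ℝ) :
    ∀ᵐ q ∂(volume : Measure (ι → ℝ)).prod volume,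
      corrDensity U φ c q.1 * corrDensity U φ c q.2 ≤ corrDensity U φ c (q.1 ⊓ q.2) * corrDensity U φ c (q.1 ⊔ q.2) := by
  filter_upwards [hsmU] with q hq
  by_cases h1 : q.1 ∈ U
  · by_cases h2 : q.2 ∈ U
    · rw [corrDensity_of_mem h1, corrDensity_of_mem h2, corrDensity_of_mem (hU.inf_mem _ h1 _ h2),
        corrDensity_of_mem (hU.sup_mem _ h1 _ h2), ← ENNReal.ofReal_mul (Real.exp_pos _).le,
        ← ENNReal.ofReal_mul (Real.exp_pos _).le, ← Real.exp_add, ← Real.exp_add]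
      refine ENNReal.ofReal_le_ofReal (Real.exp_le_exp.2 ?_)
      linarith [hq h1 h2, lineSum_modular U φ c q.1 q.2]
    · rw [corrDensity_of_not_mem h2, mul_zero]; exact zero_le
  · rw [corrDensity_of_not_mem h1, zero_mul]; exact zero_le

/-! ### The chart above a family point -/

/-- **The corrected density above a family point, from the lower-left.**  Let `c_m` be a member of the family and
`K_j` a rational box carrying a patch function.  For almost every `x > c_m` with `[c_m, x] ⊆ K_j` and `x ∈ U`,
`corrDensity(x) = F_m(x) · exp(Σᵢ (φ(c_m; i := xᵢ) − lineValue i xᵢ) − (|ι| − 1) φ(c_m))` with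
`F_m = cornerEnvelope (orthantDensity (patch φ j) c_m)` (the boxed version is a version, `boxVersion_ae_eq`).
[this work] -/
theorem ae_corrDensity_chart {U : Set (ι → ℝ)} {φ : (ι → ℝ) → ℝ} (hφ : Measurable φ) {c : ℕ → ι → ℝ}
    (hF : BandFamily U φ c) (m : ℕ) {j : (ι → ℚ) × (ι → ℚ)} (hj : ∃ g, IsPatchFn φ j g) :
    ∀ᵐ x ∂(volume : Measure (ι → ℝ)), (∀ i, c m i < x i) → Icc (c m) x ⊆ Icc (ratLo j) (ratHi j) → x ∈ U →
      corrDensity U φ c x = cornerEnvelope (orthantDensity (patch φ j) (c m)) x *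
        ENNReal.ofReal (Real.exp (∑ i, (φ (update (c m) i (x i)) - lineValue U φ c i (x i)) -
          ((Fintype.card ι : ℝ) - 1) * φ (c m))) := by
  have hgen : GenAt (patch φ j) (c m) := hF.genAt m j
  filter_upwards [boxVersion_ae_eq hφ hj hgen] with x hx hcx hK hxU
  set Fm := cornerEnvelope (orthantDensity (patch φ j) (c m)) with hFm
  have hxO : x ∈ Set.pi univ fun i => Ioi (c m i) := mem_orthant_iff.2 hcx
  have hFT : Fm x ≠ ∞ := (cornerEnvelope_orthantDensity_spec (measurable_patch hφ j)
    (ae_supermodular_patch hφ j) hgen).2.1 x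
  have hF0 : Fm x ≠ 0 := cornerEnvelope_orthantDensity_ne_zero (measurable_patch hφ j) hgen hxO
  have hFpos : 0 < (Fm x).toReal := ENNReal.toReal_pos hF0 hFT
  have hcmx : c m ≤ x := fun i => (hcx i).le
  have hpatch : ∀ y ∈ Icc (c m) x, patch φ j y = φ y := fun y hy => patch_eq_of_mem hj (hK hy)
  -- `φ x = boxVersion φ c_m x = log F_m(x) + axisSum φ c_m x`
  have h1 : φ x = Real.log (Fm x).toReal + axisSum φ (c m) x := by
    rw [← hx hcx hK, ← orthantVersion_eq_boxVersion hcmx hpatch, orthantVersion,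
      axisSum_congr hcmx hpatch ⟨hcmx, le_rfl⟩]
  rw [corrDensity_of_mem hxU, h1]
  have h2 : Real.log (Fm x).toReal + axisSum φ (c m) x - lineSum U φ c x =
      Real.log (Fm x).toReal + (∑ i, (φ (update (c m) i (x i)) - lineValue U φ c i (x i)) -
        ((Fintype.card ι : ℝ) - 1) * φ (c m)) := by
    simp only [axisSum, lineSum, Finset.sum_sub_distrib]
    ring
  rw [h2, Real.exp_add, Real.exp_log hFpos, ENNReal.ofReal_mul ENNReal.toReal_nonneg, ENNReal.ofReal_toReal hFT]

/-- The envelope factor of the chart is monotone, finite and positive on the orthant. [this work] -/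
theorem chartEnvelope_spec {U : Set (ι → ℝ)} {φ : (ι → ℝ) → ℝ} (hφ : Measurable φ) {c : ℕ → ι → ℝ}
    (hF : BandFamily U φ c) (m : ℕ) (j : (ι → ℚ) × (ι → ℚ)) :
    Monotone (cornerEnvelope (orthantDensity (patch φ j) (c m))) ∧
      (∀ x, cornerEnvelope (orthantDensity (patch φ j) (c m)) x ≠ ∞) ∧
      ∀ x, (∀ i, c m i < x i) → cornerEnvelope (orthantDensity (patch φ j) (c m)) x ≠ 0 := by
  have hgen : GenAt (patch φ j) (c m) := hF.genAt m j
  obtain ⟨-, hT, -, -, hmono⟩ := cornerEnvelope_orthantDensity_spec (measurable_patch hφ j)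
    (ae_supermodular_patch hφ j) hgen
  exact ⟨hmono, hT, fun x hx => cornerEnvelope_orthantDensity_ne_zero (measurable_patch hφ j) hgen
    (mem_orthant_iff.2 hx)⟩

/-- **Rational boxes with patch functions above a chart**: for `p` in the arm box of `c_m` there is a rational box
`K_j ⊇ [c_m, p]` inside `U` carrying a patch function. [this work] -/
theorem exists_patch_of_mem_armBox {U : Set (ι → ℝ)} (hU : IsOpenBand U) {φ : (ι → ℝ) → ℝ} (hφ : Measurable φ)
    (hsmU : ∀ᵐ q ∂(volume : Measure (ι → ℝ)).prod volume,
      q.1 ∈ U → q.2 ∈ U → φ q.1 + φ q.2 ≤ φ (q.1 ⊓ q.2) + φ (q.1 ⊔ q.2))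
    {c : ℕ → ι → ℝ} (hF : BandFamily U φ c) {m : ℕ} {p : ι → ℝ} (hp : p ∈ armBox U (c m)) :
    ∃ j : (ι → ℚ) × (ι → ℚ), (∃ g, IsPatchFn φ j g) ∧ Icc (c m) p ⊆ Icc (ratLo j) (ratHi j) := by
  have hcp : c m ≤ p := fun i => (hp.1 i).le
  obtain ⟨j, hlo, hhi, hjU⟩ := exists_rat_box_between hU.isOpen hcp (hU.Icc_subset_of_mem_armBox (hF.mem m) hp)
  refine ⟨j, exists_isPatchFn hU.isOpen hφ hsmU (fun i => (hlo i).trans_le ((hcp i).trans (hhi i).le)) hjU, ?_⟩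
  exact fun z hz => ⟨fun i => (hlo i).le.trans (hz.1 i), fun i => (hz.2 i).trans (hhi i).le⟩

/-! ### End-heights of the robust height sets -/

omit [Fintype ι] in
/-- **The end-heights** of the robust height sets of the family in direction `i` (a countable set). [this work] -/
def endpts (U : Set (ι → ℝ)) (c : ℕ → ι → ℝ) (i : ι) : Set ℝ :=
  ⋃ k, {sInf (robustSet U c i k), sSup (robustSet U c i k)}

omit [Fintype ι] in
/-- The end-heights form a countable set. [folklore] -/
theorem countable_endpts (U : Set (ι → ℝ)) (c : ℕ → ι → ℝ) (i : ι) : (endpts U c i).Countable :=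
  Set.countable_iUnion fun _ => ((Set.finite_singleton _).insert _).countable

omit [Fintype ι] in
/-- **Off the end-heights the left-selected index is the index selected at the height itself.**  If the left
selection near `t₀` is `κ` (in the sense of `exists_gIdx_eq_left`) and `t₀` is not an end-height then
`gIdx U c i t₀ = κ`. [this work] -/
theorem gIdx_eq_of_not_mem_endpts {U : Set (ι → ℝ)} (hU : IsOpenBand U) {c : ℕ → ι → ℝ} {i : ι} {t₀ ε : ℝ}
    {κ : ℕ} (hε : 0 < ε) (hsel : ∀ t ∈ Ioo (t₀ - ε) t₀, t ∈ robustSet U c i κ ∧ ∀ k < κ, t ∉ robustSet U c i k)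
    (ht₀ : t₀ ∉ endpts U c i) : gIdx U c i t₀ = κ := by
  classical
  have hord : ∀ k, OrdConnected (robustSet U c i k) := fun k => hU.ordConnected_robust c i k
  have hnot : ∀ k, t₀ ≠ sInf (robustSet U c i k) ∧ t₀ ≠ sSup (robustSet U c i k) := fun k => by
    constructor <;> intro h <;> exact ht₀ (Set.mem_iUnion.2 ⟨k, by simp [h]⟩)
  -- `t₀` itself is a robust height of `c_κ`
  have hκ : t₀ ∈ robustSet U c i κ := by
    by_contra hn
    have hsub : robustSet U c i κ ⊆ Iio t₀ := fun u hu => by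
      rcases lt_or_ge u t₀ with h | hge
      · exact h
      · exfalso
        rcases hge.eq_or_lt with h | h
        · exact hn (h ▸ hu)
        · have hmid := (hsel (t₀ - ε / 2) ⟨by linarith, by linarith⟩).1
          exact hn ((hord κ).out hmid hu ⟨by linarith, h.le⟩)
    have hne : (robustSet U c i κ).Nonempty := ⟨t₀ - ε / 2, (hsel (t₀ - ε / 2) ⟨by linarith, by linarith⟩).1⟩
    have hbdd : BddAbove (robustSet U c i κ) := ⟨t₀, fun u hu => (hsub hu).le⟩
    refine (hnot κ).2 (le_antisymm ?_ (csSup_le hne fun u hu => (hsub hu).le))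
    refine le_of_forall_lt fun v hv => ?_
    set u := max ((v + t₀) / 2) (t₀ - ε / 2) with hu
    have hvu : v < u := lt_max_of_lt_left (by linarith)
    have hut : u < t₀ := max_lt (by linarith) (by linarith)
    have huε : t₀ - ε < u := lt_of_lt_of_le (by linarith) (le_max_right _ _)
    exact hvu.trans_le (le_csSup hbdd (hsel u ⟨huε, hut⟩).1)
  -- no earlier member is robust at `t₀`
  have hlt : ∀ k < κ, t₀ ∉ robustSet U c i k := fun k hk hk0 => by
    have hsub : robustSet U c i k ⊆ Ici t₀ := fun u hu => by
      rcases le_or_gt t₀ u with h | hlt'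
      · exact h
      · exfalso
        have hmid : max u (t₀ - ε / 2) ∈ Ioo (t₀ - ε) t₀ :=
          ⟨by have := le_max_right u (t₀ - ε / 2); linarith, max_lt hlt' (by linarith)⟩
        exact (hsel _ hmid).2 k hk ((hord k).out hu hk0 ⟨le_max_left _ _, hmid.2.le⟩)
    have hne : (robustSet U c i k).Nonempty := ⟨t₀, hk0⟩
    have hbdd : BddBelow (robustSet U c i k) := ⟨t₀, fun u hu => hsub hu⟩
    exact (hnot k).1 (le_antisymm (le_csInf hne fun u hu => hsub hu) (csInf_le hbdd hk0))
  rw [gIdx, Nat.find_eq_iff]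
  refine ⟨Or.inr hκ, fun k hk hsel' => ?_⟩
  rcases hsel' with hnone | hk'
  · exact hnone κ hκ
  · exact hlt k hk hk'

/-! ### One-dimensional charts at a point -/

/-- **One-dimensional charts at a point of an arm box.**  For `p ∈ armBox U c_m` and a direction `i` there are
an index `κ`, a member `c_l` above `c_m` and `c_κ` off `i`, and a rational window `w` around `pᵢ` such that both
charts `(i, l, m, w)` and `(i, l, κ, w)` are valid, `c_κ` is the selected line at every height of the inner window
below `pᵢ`, and also at `pᵢ` unless `pᵢ` is an end-height. [this work] -/
theorem exists_coordChart {U : Set (ι → ℝ)} (hU : IsOpenBand U) {φ : (ι → ℝ) → ℝ} {c : ℕ → ι → ℝ}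
    (hF : BandFamily U φ c) {m : ℕ} {p : ι → ℝ} (hp : p ∈ armBox U (c m)) (i : ι) :
    ∃ (κ l : ℕ) (w : ℚ × ℚ × ℚ × ℚ), GapValid U c i l m w ∧ GapValid U c i l κ w ∧
      winLo' w < p i ∧ p i < winHi' w ∧
      (∀ t ∈ Ioo (winLo' w) (p i), lineValue U φ c i t = φ (update (c κ) i t)) ∧
      (p i ∉ endpts U c i → lineValue U φ c i (p i) = φ (update (c κ) i (p i))) := by
  have hpU : p ∈ U := hU.armBox_subset (hF.mem m) hp
  -- left selection at `pᵢ`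
  obtain ⟨κ, ε₁, hε₁, hκline, hκsel, hκidx⟩ :=
    exists_gIdx_eq_left hU c (hU.exists_robust hF.dense hpU i)
  -- the line of `c_m` near `pᵢ`
  obtain ⟨ε₂, hε₂, hmline⟩ : ∃ ε₂ > 0, ∀ s, |s - p i| < ε₂ → update (c m) i s ∈ U := by
    obtain ⟨ε₂, hε₂, hball⟩ := Metric.isOpen_iff.1 (isOpen_lineSection hU.isOpen (c m) i) (p i) (hp.2 i)
    exact ⟨ε₂, hε₂, fun s hs => hball (by rw [Metric.mem_ball, Real.dist_eq]; exact hs)⟩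
  set ε := min ε₁ ε₂ with hε
  have hεpos : 0 < ε := lt_min hε₁ hε₂
  obtain ⟨l, hl, hlline⟩ := hU.exists_line_above hF.dense (i := i) (t₀ := p i) hεpos
    (fun s hs => hmline s (hs.trans_le (min_le_right _ _))) (fun s hs => hκline s (hs.trans_le (min_le_left _ _)))
  -- a rational window inside `(pᵢ - ε/2, pᵢ + ε/2)`
  obtain ⟨a, ha1, ha2⟩ := exists_rat_btwn (show p i - ε / 2 < p i - ε / 4 by linarith)
  obtain ⟨a', ha'1, ha'2⟩ := exists_rat_btwn (show p i - ε / 4 < p i by linarith)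
  obtain ⟨b', hb'1, hb'2⟩ := exists_rat_btwn (show p i < p i + ε / 4 by linarith)
  obtain ⟨b, hb1, hb2⟩ := exists_rat_btwn (show p i + ε / 4 < p i + ε / 2 by linarith)
  set w : ℚ × ℚ × ℚ × ℚ := (a, a', b', b) with hw
  have hwin : ∀ s ∈ Ioo (winLo w) (winHi w), |s - p i| < ε / 2 := fun s hs => by
    simp only [winLo, winHi, hw] at hs
    rw [abs_lt]; constructor <;> linarith [hs.1, hs.2]
  have hvalid : ∀ k, (∀ j, j ≠ i → c k j ≤ c l j) → (∀ s, |s - p i| < ε → update (c k) i s ∈ U) →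
      GapValid U c i l k w := fun k hk hkline =>
    ⟨by simp only [winLo, winLo', hw]; exact_mod_cast show (a : ℝ) < a' by linarith,
      by simp only [winLo', winHi', hw]; exact_mod_cast show (a' : ℝ) ≤ b' by linarith,
      by simp only [winHi', winHi, hw]; exact_mod_cast show (b' : ℝ) < b by linarith, hk,
      fun s hs => hkline s ((hwin s hs).trans (by linarith)), fun s hs => hlline s (hwin s hs)⟩
  refine ⟨κ, l, w, hvalid m (fun j hj => (le_max_left _ _).trans (hl j hj).le)
      (fun s hs => hmline s (hs.trans_le (min_le_right _ _))),
    hvalid κ (fun j hj => (le_max_right _ _).trans (hl j hj).le)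
      (fun s hs => hκline s (hs.trans_le (min_le_left _ _))), ?_, ?_, fun t ht => ?_, fun hpi => ?_⟩
  · simp only [winLo', hw]; exact ha'2
  · simp only [winHi', hw]; exact hb'1
  · have ht' : t ∈ Ioo (p i - ε₁) (p i) := ⟨by
      simp only [winLo', hw] at ht
      linarith [ht.1, min_le_left ε₁ ε₂], ht.2⟩
    rw [lineValue, hκidx t ht']
  · rw [lineValue, gIdx_eq_of_not_mem_endpts hU hε₁ hκsel hpi]

end Summit.CriticalPhenomena.PercolationContinuityZ3.Theorems.SahiAEFourFunctions
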